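import Mathlib
import HarnessLib
import Summits.NavierStokesRegularity.NavierStokesRegularity.Theorems.PoloidalWindowRigidity.Negative.TriWaveField
import Literature.Algebra.EuclideanLattices.FccBccLattices

/-!
# Crux `PoloidalWindowRigidity` (K2, stmt-NavierStokesRegularity-19708) — negative side:
# the THREE-WAVE poloidal frozen profile, a kinematic witness of the rev-10 clause (vii)

Negative-side support (refuter seat ns-regularity-refuter1 gen 2, cell ns-regularity-ideate; D-0081 §C).

The rev-10 residue stub S2⁗ (`Cruxes/PoloidalWindowRigidity/Lines/slicesharp.lean`, line `slicesharp-screw`) adds to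
S2‴ the clause (vii) «super-critical vorticity production near every vorticity record»:
`∀ θ ≥ 0, ∀ s₀ < 0, ∀ y₀, θ < (−s₀)²|ω(s₀,y₀)|² → ∃ s < 0, ∃ y, θ < (−s)²|ω(s,y)|² ∧ |ω|² < (−s)⟪ω, Dv ω⟫`.
The drifting cellular witness of the negative lane fails (vii) (`…Negative.NearPeakDrift`).  This file supplies a
poloidal frozen Type-I profile that MEETS it, with every class datum except the Oseen-mild identity (M):

* the THREE-WAVE FIELD `T = (∂₀φ, ∂₁φ, −∂₂φ)`, `φ = 2 sin(x₀+x₂) + 2 sin(x₁−x₂) + 2 sin(x₁+x₂)` (three solutions of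
  `∂₂²φ = Δ_h φ`):  `T = (2cos u, 2cos w + 2cos p, −2cos u + 2cos w − 2cos p)`, `u = x₀+x₂`, `w = x₁−x₂`, `p = x₁+x₂`;
  `div T = 0`, `curl T = (−4 sin w + 4 sin p, −4 sin u, 0)` (poloidal along `e₂`), `(DT · curl T)·e₂ = 0` (frozen);
* the Type-I profile WITH LOGARITHMIC DRIFT `v(t,x) = (−t)^{-1/2} T((−t)^{-1/2}x + log(−t) e₁)` (`triProfile`): rate
  `‖v(t)‖ ≤ 12(−t)^{-1/2}`, continuity on the slab, scale-sharp ClassRates `‖Dv(t)‖ ≤ 24/(−t)`, `‖curl v(t)‖ ≤ 12/(−t)`,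
  divergence-free, poloidal, frozen, backward-singular at the apex (`v₀ = 2(−t)^{-1/2}cos((−t)^{-1/2}(x₀+x₂))` does
  not see the drift);
* `triProfile_nearPeakSupercritical`: (vii) HOLDS, and NON-VACUOUSLY — `(−s)²|ω|²` is the bounded function
  `|curl T|² ≤ 80` of the similarity variable, and at the record `(s,y) = (−1, −(π/2)e₂)` one has
  `|ω|² = 80 < 128 = (−s)⟪ω, Dv ω⟫` (`curl_triField_record`; production/critical ratio `8/5`).

Status of (vii): it is a proved NECESSARY CONDITION of the mild class (p484908
`critEnstrophy_le_of_critical_production_above`); the EXCLUSION «(vii) + the other hypotheses of S2⁗ ⇒ no singularity»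
is the open stub `stub_residueSupercriticalNearPeak` itself, not a theorem.  This file shows that (vii) is satisfiable
non-vacuously (non-zero vorticity) by a non-mild profile with both ClassRates; the genericity clauses of S2⁗ for this
witness and the full certificate «S2⁗ with (M) ↦ ClassRates is false» are the sequel files (`…TriWaveGenericity`,
`…TriWaveScrew`, `…TriWaveFrame`, `…TriWaveGauge`, `…ResidueRev10False`).  WHAT THIS IS NOT: not a claim about
Navier–Stokes — kinematics of an explicit profile; the crux K2 stays open. [folklore]
-/

noncomputable section

-- the summit and its single sub-problem share the name (CONVENTIONS §1), as in every Theorems file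
set_option linter.dupNamespace false

namespace Summit.NavierStokesRegularity.NavierStokesRegularity.Theorems.PoloidalWindowRigidity.Negative

open MeasureTheory Set Function Filter Topology Metric
open scoped RealInnerProductSpace InnerProductSpace ENNReal NNReal
open Literature.Analysis Literature.Analysis.FluidPDE

local notation "E3" => EuclideanSpace ℝ (Fin 3)
local notation "𝐞" i => (EuclideanSpace.single (i : Fin 3) (1 : ℝ) : EuclideanSpace ℝ (Fin 3))

/-! ## The three-wave Type-I profile with logarithmic drift -/

/-- The three-wave Type-I profile `v(t,x) = (−t)^{-1/2} T((−t)^{-1/2} x + log(−t) e₁)`. [folklore] -/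
def triProfile (t : ℝ) (x : E3) : E3 :=
  cellAmp t • triField (driftShift t x)

/-- `(−1)^{-1/2} = 1`. [folklore] -/
theorem cellAmp_neg_one : cellAmp (-1) = 1 := by
  simp [cellAmp]

/-- On the slice `t = −1` the profile is the three-wave field. [folklore] -/
theorem triProfile_neg_one : triProfile (-1) = triField := by
  funext x
  simp only [triProfile, driftShift_neg_one, cellAmp_neg_one, one_smul]

/-- `Dv(t)(x) = (−t)^{-1/2} DT(A_t x) ∘ DA_t`. [folklore] -/
theorem hasFDerivAt_triProfile (t : ℝ) (x : E3) :
    HasFDerivAt (triProfile t)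
      (cellAmp t • ((triDeriv (driftShift t x)).comp (cellAmp t • ContinuousLinearMap.id ℝ E3))) x := by
  show HasFDerivAt (fun x => cellAmp t • triField (driftShift t x)) _ x
  exact ((hasFDerivAt_triField (driftShift t x)).comp x (hasFDerivAt_driftShift t x)).const_smul (cellAmp t)

/-- `Dv(t)(x) w` in coordinates: `(−t)^{-1} (DT(A_t x) w)ᵢ`. [folklore] -/
theorem fderiv_triProfile_apply (t : ℝ) (x w : E3) (i : Fin 3) :
    fderiv ℝ (triProfile t) x w i = cellAmp t ^ 2 * triDeriv (driftShift t x) w i := by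
  rw [(hasFDerivAt_triProfile t x).fderiv]
  simp [sq, mul_assoc]

/-- `Dv(t)(x) = (−t)^{-1} DT(A_t x)` as continuous linear maps. [folklore] -/
theorem fderiv_triProfile (t : ℝ) (x : E3) :
    fderiv ℝ (triProfile t) x = (cellAmp t ^ 2) • triDeriv (driftShift t x) := by
  ext w i
  rw [fderiv_triProfile_apply]
  simp

/-- **The scale-sharp gradient rate**: `‖Dv(t)(x)‖ ≤ 24/(−t)`. [folklore] -/
theorem norm_fderiv_triProfile_le {t : ℝ} (ht : t < 0) (x : E3) : ‖fderiv ℝ (triProfile t) x‖ ≤ 24 / (-t) := by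
  rw [fderiv_triProfile, norm_smul, Real.norm_of_nonneg (sq_nonneg _), cellAmp_sq ht, div_eq_inv_mul]
  refine mul_le_mul_of_nonneg_left ?_ (inv_nonneg.2 (by linarith))
  exact ContinuousLinearMap.opNorm_le_bound _ (by norm_num) (norm_triDeriv_apply_le _)

/-- `curl v(t) = (−t)^{-1} (curl T)(A_t x)`, in coordinates. [folklore] -/
theorem curl_triProfile (t : ℝ) (x : E3) : curl (triProfile t) x =
    (cellAmp t ^ 2 * (-4 * Real.sin (driftShift t x 1 - driftShift t x 2) +
        4 * Real.sin (driftShift t x 1 + driftShift t x 2))) • (𝐞 0) +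
      (cellAmp t ^ 2 * (-4 * Real.sin (driftShift t x 0 + driftShift t x 2))) • (𝐞 1) := by
  ext i
  fin_cases i <;>
    simp [curl, fderiv_triProfile, triDeriv_apply_zero, triDeriv_apply_one, triDeriv_apply_two] <;> ring

/-- The first component of `curl v(t)(x)`. [folklore] -/
theorem curl_triProfile_apply_zero (t : ℝ) (x : E3) : curl (triProfile t) x 0 =
    cellAmp t ^ 2 * (-4 * Real.sin (driftShift t x 1 - driftShift t x 2) +
      4 * Real.sin (driftShift t x 1 + driftShift t x 2)) := by
  rw [curl_triProfile]; simp

/-- The second component of `curl v(t)(x)`. [folklore] -/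
theorem curl_triProfile_apply_one (t : ℝ) (x : E3) :
    curl (triProfile t) x 1 = cellAmp t ^ 2 * (-4 * Real.sin (driftShift t x 0 + driftShift t x 2)) := by
  rw [curl_triProfile]; simp

/-- The third component of `curl v(t)(x)` vanishes. [folklore] -/
theorem curl_triProfile_apply_two (t : ℝ) (x : E3) : curl (triProfile t) x 2 = 0 := by
  rw [curl_triProfile]; simp

/-- **The vorticity rate**: `‖curl v(t)(x)‖ ≤ 12/(−t)`. [folklore] -/
theorem norm_curl_triProfile_le {t : ℝ} (ht : t < 0) (x : E3) : ‖curl (triProfile t) x‖ ≤ 12 / (-t) := by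
  have e0 : ‖(𝐞 0)‖ = 1 := by simp
  have e1 : ‖(𝐞 1)‖ = 1 := by simp
  have hsq := cellAmp_sq ht
  have hpos : 0 < (-t)⁻¹ := inv_pos.2 (by linarith)
  have hs0 := Real.abs_sin_le_one (driftShift t x 0 + driftShift t x 2)
  have hs1 := Real.abs_sin_le_one (driftShift t x 1 - driftShift t x 2)
  have hs2 := Real.abs_sin_le_one (driftShift t x 1 + driftShift t x 2)
  have hA : |cellAmp t ^ 2 * (-4 * Real.sin (driftShift t x 1 - driftShift t x 2) +
      4 * Real.sin (driftShift t x 1 + driftShift t x 2))| ≤ 8 * (-t)⁻¹ := by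
    rw [abs_mul, hsq, abs_of_pos hpos]
    have h : |-4 * Real.sin (driftShift t x 1 - driftShift t x 2) + 4 * Real.sin (driftShift t x 1 + driftShift t x 2)|
        ≤ 8 := by
      refine (abs_add_le _ _).trans ?_
      rw [abs_mul, abs_mul, show |(-4 : ℝ)| = 4 by norm_num, show |(4 : ℝ)| = 4 by norm_num]
      linarith
    nlinarith
  have hB : |cellAmp t ^ 2 * (-4 * Real.sin (driftShift t x 0 + driftShift t x 2))| ≤ 4 * (-t)⁻¹ := by
    rw [abs_mul, hsq, abs_of_pos hpos, abs_mul, show |(-4 : ℝ)| = 4 by norm_num]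
    nlinarith
  rw [curl_triProfile]
  refine (norm_add_le _ _).trans ?_
  rw [norm_smul, norm_smul, e0, e1, mul_one, mul_one, Real.norm_eq_abs, Real.norm_eq_abs, div_eq_inv_mul]
  linarith

/-! ## The slice identities (R), (C), (D), (P), (F) -/

/-- (R) the Type-I time rate with constant `12`. [folklore] -/
theorem hasTypeITimeDecay_triProfile : HasTypeITimeDecay 12 triProfile := by
  intro t ht x
  show ‖cellAmp t • triField (driftShift t x)‖ ≤ 12 / Real.sqrt (-t)
  rw [norm_smul, Real.norm_of_nonneg (cellAmp_nonneg t), cellAmp, div_eq_inv_mul]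
  exact mul_le_mul_of_nonneg_left (norm_triField_le _) (inv_nonneg.2 (Real.sqrt_nonneg _))

/-- (C) continuity on the open backward slab. [folklore] -/
theorem continuousOn_triProfile : ContinuousOn (Function.uncurry triProfile) (Set.Iio (0 : ℝ) ×ˢ Set.univ) := by
  have hamp : ContinuousOn (fun z : ℝ × E3 => cellAmp z.1) (Set.Iio (0 : ℝ) ×ˢ Set.univ) := by
    refine ContinuousOn.inv₀ ?_ fun z hz => (Real.sqrt_pos.2 (neg_pos.2 (show z.1 < 0 from hz.1))).ne'
    exact ((Real.continuous_sqrt.comp continuous_neg).comp continuous_fst).continuousOn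
  have hlog : ContinuousOn (fun z : ℝ × E3 => Real.log (-z.1)) (Set.Iio (0 : ℝ) ×ˢ Set.univ) :=
    (continuous_neg.comp continuous_fst).continuousOn.log fun z hz => (neg_pos.2 (show z.1 < 0 from hz.1)).ne'
  have hshift : ContinuousOn (fun z : ℝ × E3 => driftShift z.1 z.2) (Set.Iio (0 : ℝ) ×ˢ Set.univ) :=
    (hamp.smul continuousOn_snd).add (hlog.smul continuousOn_const)
  exact hamp.smul (continuous_triField.comp_continuousOn hshift)

/-- (D) divergence-free slices. [folklore] -/
theorem isDivFree_triProfile (t : ℝ) : VectorCalculus.IsDivFree (triProfile t) := by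
  intro y
  rw [divergence_eq_sum_inner_fderiv (EuclideanSpace.basisFun (Fin 3) ℝ), Fin.sum_univ_three]
  simp only [EuclideanSpace.basisFun_apply, EuclideanSpace.inner_single_left, map_one, one_mul,
    fderiv_triProfile_apply]
  have h := triDeriv_trace (driftShift t y)
  calc cellAmp t ^ 2 * triDeriv (driftShift t y) (EuclideanSpace.single 0 1) 0 +
        cellAmp t ^ 2 * triDeriv (driftShift t y) (EuclideanSpace.single 1 1) 1 +
        cellAmp t ^ 2 * triDeriv (driftShift t y) (EuclideanSpace.single 2 1) 2
      = cellAmp t ^ 2 * (triDeriv (driftShift t y) (𝐞 0) 0 + triDeriv (driftShift t y) (𝐞 1) 1 +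
          triDeriv (driftShift t y) (𝐞 2) 2) := by ring
    _ = 0 := by rw [h, mul_zero]

/-- (P) poloidal along `e₂` everywhere on every slice. [folklore] -/
theorem poloidal_triProfile (s : ℝ) (y : E3) : ⟪curl (triProfile s) y, (𝐞 2)⟫_ℝ = 0 := by
  rw [EuclideanSpace.inner_single_right, curl_triProfile_apply_two]
  simp

/-- (F) the frozen constraint `⟪Dv(s)(y) curl v(s)(y), e₂⟫ = 0`. [folklore] -/
theorem frozen_triProfile (s : ℝ) (y : E3) : ⟪fderiv ℝ (triProfile s) y (curl (triProfile s) y), (𝐞 2)⟫_ℝ = 0 := by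
  rw [EuclideanSpace.inner_single_right, fderiv_triProfile_apply, triDeriv_apply_two, curl_triProfile_apply_zero,
    curl_triProfile_apply_one, curl_triProfile_apply_two, RCLike.conj_to_real]
  ring

/-! ## The singularity at the apex -/

/-- **(S) the three-wave profile is backward-singular at the apex**: for `(t, x) ∈ (−τ, −τ/2) × B(0, √(τ/2)/2)` the
similarity variable has `|(A_t x)₀|, |(A_t x)₂| ≤ ½`, so `cos((A_t x)₀ + (A_t x)₂) ≥ ½` and
`‖v(t, x)‖ ≥ |v₀(t,x)| ≥ (−t)^{-1/2}` (the drift acts on the coordinate `1`, which `v₀` does not see). [folklore] -/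
theorem isBackwardSingularPoint_triProfile : IsBackwardSingularPoint triProfile 0 := by
  intro r hr
  rw [eLpNorm_exponent_top]
  show essSup (fun z => ‖uncurry triProfile z‖ₑ) _ = ⊤
  apply essSup_eq_top_of_forall_exists_lt
  intro N
  set K : ℝ := (N : ℝ) + 1 with hK
  have hKpos : 0 < K := by positivity
  set C : ℝ := 1 with hCdef
  have hC : 0 < C := by norm_num
  set τ : ℝ := min (r ^ 2) ((C / K) ^ 2) / 2 with hτ
  have hmin : 0 < min (r ^ 2) ((C / K) ^ 2) := lt_min (by positivity) (by positivity)
  have hτpos : 0 < τ := by positivity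
  have hτr : τ < r ^ 2 := by
    have := min_le_left (r ^ 2) ((C / K) ^ 2)
    rw [hτ]; linarith
  have hτK : τ < (C / K) ^ 2 := by
    have := min_le_right (r ^ 2) ((C / K) ^ 2)
    rw [hτ]; linarith
  set ρ : ℝ := Real.sqrt (τ / 2) / 2 with hρ
  have hρpos : 0 < ρ := by positivity
  have hρr : ρ ≤ r := by
    have h1 : Real.sqrt (τ / 2) ≤ r := by
      rw [← Real.sqrt_sq hr.le]
      exact Real.sqrt_le_sqrt (by linarith)
    have h2 : 0 ≤ Real.sqrt (τ / 2) := Real.sqrt_nonneg _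
    rw [hρ]; linarith
  refine ⟨Ioo (-τ) (-(τ / 2)) ×ˢ ball 0 ρ, ?_, ?_⟩
  · have hsub : Ioo (-τ) (-(τ / 2)) ×ˢ ball (0 : E3) ρ ⊆ parabolicCylinder r (0 : ℝ × E3) := by
      rintro ⟨t, x⟩ ⟨⟨ht1, ht2⟩, hx⟩
      rw [mem_parabolicCylinder]
      refine ⟨⟨?_, ?_⟩, ?_⟩
      · simp only [Prod.fst_zero]; linarith
      · simp only [Prod.fst_zero]; linarith
      · simp only [Prod.snd_zero]
        exact lt_of_lt_of_le (mem_ball.1 hx) hρr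
    rw [Measure.restrict_apply (measurableSet_Ioo.prod measurableSet_ball),
      inter_eq_left.2 hsub, Measure.volume_eq_prod, Measure.prod_prod]
    refine mul_ne_zero ?_ (measure_ball_pos volume (0 : E3) hρpos).ne'
    rw [Real.volume_Ioo, ne_eq, ENNReal.ofReal_eq_zero, not_le]
    linarith
  · rintro ⟨t, x⟩ ⟨⟨ht1, ht2⟩, hx⟩
    simp only [uncurry_apply_pair]
    have hxρ : ‖x‖ < ρ := mem_ball_zero_iff.1 hx
    have hspos : 0 < Real.sqrt (-t) := Real.sqrt_pos.2 (by linarith)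
    have hamp : cellAmp t = (Real.sqrt (-t))⁻¹ := rfl
    -- the similarity variable stays in the half box in the coordinates 0 and 2
    have hρt : 2 * ρ ≤ Real.sqrt (-t) := by
      rw [hρ, mul_div_cancel₀ _ (two_ne_zero)]
      exact Real.sqrt_le_sqrt (by linarith)
    have hcx : cellAmp t * ‖x‖ ≤ 1 / 2 := by
      have h1 : cellAmp t * (2 * ‖x‖) ≤ cellAmp t * Real.sqrt (-t) :=
        mul_le_mul_of_nonneg_left (by linarith [hxρ.le]) (cellAmp_nonneg t)
      have h2 : cellAmp t * Real.sqrt (-t) = 1 := by rw [hamp]; exact inv_mul_cancel₀ hspos.ne'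
      linarith
    have hbox : ∀ i : Fin 3, |cellAmp t * x i| ≤ 1 / 2 := by
      intro i
      rw [abs_mul, abs_of_nonneg (cellAmp_nonneg t)]
      have hxi : |x i| ≤ ‖x‖ := by
        have := PiLp.norm_apply_le x i
        rwa [Real.norm_eq_abs] at this
      exact (mul_le_mul_of_nonneg_left hxi (cellAmp_nonneg t)).trans hcx
    have hpi3 : (1 : ℝ) ≤ Real.pi / 3 := by linarith [Real.pi_gt_three]
    have hcos : ∀ u : ℝ, |u| ≤ 1 → 1 / 2 ≤ Real.cos u := by
      intro u hu
      rw [← Real.cos_abs, ← Real.cos_pi_div_three]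
      exact Real.cos_le_cos_of_nonneg_of_le_pi (abs_nonneg _) (by linarith [Real.pi_pos]) (hu.trans hpi3)
    have hu : |driftShift t x 0 + driftShift t x 2| ≤ 1 := by
      rw [driftShift_apply_zero, driftShift_apply_two]
      have := abs_add_le (cellAmp t * x 0) (cellAmp t * x 2)
      linarith [hbox 0, hbox 2]
    have hc0 : 1 / 2 ≤ Real.cos (driftShift t x 0 + driftShift t x 2) := hcos _ hu
    -- lower bound on the first component
    have hlow : C / Real.sqrt (-t) ≤ ‖triProfile t x‖ := by
      have h0 : triProfile t x 0 = cellAmp t * (2 * Real.cos (driftShift t x 0 + driftShift t x 2)) := by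
        simp only [triProfile, PiLp.smul_apply, smul_eq_mul, triField_apply_zero]
      calc C / Real.sqrt (-t) = cellAmp t * C := by rw [hamp, div_eq_inv_mul]
        _ ≤ cellAmp t * (2 * Real.cos (driftShift t x 0 + driftShift t x 2)) :=
            mul_le_mul_of_nonneg_left (by rw [hCdef]; linarith) (cellAmp_nonneg t)
        _ = |triProfile t x 0| := by
            rw [h0, abs_of_nonneg (mul_nonneg (cellAmp_nonneg t) (by linarith))]
        _ = ‖triProfile t x 0‖ := (Real.norm_eq_abs _).symm
        _ ≤ ‖triProfile t x‖ := PiLp.norm_apply_le _ 0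
    rw [← ofReal_norm, show ((N : ℝ≥0) : ℝ≥0∞) = ENNReal.ofReal (N : ℝ) by simp]
    rw [ENNReal.ofReal_lt_ofReal_iff (lt_of_lt_of_le (div_pos hC hspos) hlow)]
    refine lt_of_lt_of_le ?_ hlow
    rw [lt_div_iff₀ hspos]
    have hst : Real.sqrt (-t) < C / K := by
      rw [Real.sqrt_lt' (div_pos hC hKpos)]
      linarith
    calc (N : ℝ) * Real.sqrt (-t) ≤ K * Real.sqrt (-t) :=
          mul_le_mul_of_nonneg_right (by rw [hK]; linarith) hspos.le
      _ < K * (C / K) := mul_lt_mul_of_pos_left hst hKpos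
      _ = C := by field_simp

/-! ## Clause (vii): super-critical production near every vorticity record -/

/-- `(−s)²|curl v(s)(y)|² = |curl T(A_s y)|² ≤ 80` on every slice `s < 0`. [folklore] -/
theorem critEnstrophy_triProfile {s : ℝ} (hs : s < 0) (y : E3) :
    (-s) ^ 2 * ⟪curl (triProfile s) y, curl (triProfile s) y⟫_ℝ =
      (-4 * Real.sin (driftShift s y 1 - driftShift s y 2) + 4 * Real.sin (driftShift s y 1 + driftShift s y 2)) ^ 2 +
        (-4 * Real.sin (driftShift s y 0 + driftShift s y 2)) ^ 2 := by
  have h1 : (-s) * cellAmp s ^ 2 = 1 := by rw [cellAmp_sq hs]; exact mul_inv_cancel₀ (by linarith)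
  rw [Literature.Algebra.EuclideanLattices.inner_fin_three, curl_triProfile_apply_zero, curl_triProfile_apply_one,
    curl_triProfile_apply_two]
  have : (-s) ^ 2 * (cellAmp s ^ 2) ^ 2 = 1 := by rw [← mul_pow, h1, one_pow]
  linear_combination ((-4 * Real.sin (driftShift s y 1 - driftShift s y 2) +
    4 * Real.sin (driftShift s y 1 + driftShift s y 2)) ^ 2 + (-4 * Real.sin (driftShift s y 0 + driftShift s y 2)) ^ 2) *
    this

/-- The record point `y⋆ = −(π/2) e₂` of the slice `s = −1`: `curl T(y⋆) = (−8, 4, 0)`. [folklore] -/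
theorem curl_triField_record :
    curl triField ((-(Real.pi / 2)) • (𝐞 2)) = (-8 : ℝ) • (𝐞 0) + (4 : ℝ) • (𝐞 1) := by
  rw [curl_triField]
  have h0 : ((-(Real.pi / 2)) • (𝐞 2) : E3) 0 = 0 := by simp
  have h1 : ((-(Real.pi / 2)) • (𝐞 2) : E3) 1 = 0 := by simp
  have h2 : ((-(Real.pi / 2)) • (𝐞 2) : E3) 2 = -(Real.pi / 2) := by simp
  simp only [h0, h1, h2, zero_add, zero_sub, neg_neg, Real.sin_pi_div_two, Real.sin_neg]
  norm_num

/-- **Clause (vii) of S2⁗ HOLDS for the three-wave profile**: near (indeed above) every value of the critical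
enstrophy `(−s)²|ω|²` there is a point of super-critical production — the record `(−1, −(π/2)e₂)`, where
`|ω|² = 80 < 128 = (−s)⟪ω, Dv ω⟫`. [folklore] -/
theorem triProfile_nearPeakSupercritical :
    ∀ θ : ℝ, 0 ≤ θ → ∀ s₀ < 0, ∀ y₀ : E3,
      θ < (-s₀) ^ 2 * ⟪curl (triProfile s₀) y₀, curl (triProfile s₀) y₀⟫_ℝ →
      ∃ s < 0, ∃ y : E3, θ < (-s) ^ 2 * ⟪curl (triProfile s) y, curl (triProfile s) y⟫_ℝ ∧
        ⟪curl (triProfile s) y, curl (triProfile s) y⟫_ℝ <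
          (-s) * ⟪curl (triProfile s) y, fderiv ℝ (triProfile s) y (curl (triProfile s) y)⟫_ℝ := by
  intro θ _ s₀ hs₀ y₀ hθ
  have h80 : θ < 80 := by
    rw [critEnstrophy_triProfile hs₀] at hθ
    exact lt_of_lt_of_le hθ (curl_triField_sq_le _)
  refine ⟨-1, by norm_num, (-(Real.pi / 2)) • (𝐞 2), ?_, ?_⟩
  · rw [triProfile_neg_one, curl_triField_record, Literature.Algebra.EuclideanLattices.inner_fin_three]
    simp
    linarith
  · rw [triProfile_neg_one, curl_triField_record, fderiv_triField, Literature.Algebra.EuclideanLattices.inner_fin_three,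
      Literature.Algebra.EuclideanLattices.inner_fin_three, triDeriv_apply_zero, triDeriv_apply_one, triDeriv_apply_two]
    have h0 : ((-(Real.pi / 2)) • (𝐞 2) : E3) 0 = 0 := by simp
    have h1 : ((-(Real.pi / 2)) • (𝐞 2) : E3) 1 = 0 := by simp
    have h2 : ((-(Real.pi / 2)) • (𝐞 2) : E3) 2 = -(Real.pi / 2) := by simp
    have w0 : ((-8 : ℝ) • (𝐞 0) + (4 : ℝ) • (𝐞 1) : E3) 0 = -8 := by simp
    have w1 : ((-8 : ℝ) • (𝐞 0) + (4 : ℝ) • (𝐞 1) : E3) 1 = 4 := by simp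
    have w2 : ((-8 : ℝ) • (𝐞 0) + (4 : ℝ) • (𝐞 1) : E3) 2 = 0 := by simp
    simp only [h0, h1, h2, w0, w1, w2, zero_add, zero_sub, neg_neg, Real.sin_pi_div_two, Real.sin_neg]
    norm_num

end Summit.NavierStokesRegularity.NavierStokesRegularity.Theorems.PoloidalWindowRigidity.Negative

end
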